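import Literature.MathematicalPhysics.QuantumManyBody.PeriodicFeynmanKacCompact
import Literature.MathematicalPhysics.QuantumManyBody.GroundStateFeynmanKacPerronFrobenius
import HarnessLib

/-!
# Periodic Feynman–Kac: positivity improving and the Perron–Frobenius theorem on `L²(cell)`

Topic `Literature/MathematicalPhysics/QuantumManyBody`; theorems only. Step of the proof of the
named fact `Literature.MathematicalPhysics.QuantumManyBody.BoseGas.PeriodicGroundStateFeynmanKac`
(`PeriodicHeatFlowSpectral.lean`); torus twin of `GroundStateFeynmanKacPositivity.lean` and
`GroundStateFeynmanKacPerronFrobenius.lean`: the abstract argument of Reed–Simon IV Thm XIII.44 /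
Glimm–Jaffe Thms 3.3.2–3.3.3 ("positivity improving ⇒ the ground state is unique and strictly
positive"), run for the compact positive self-adjoint operator `T = pfkL2 v L t` on
`L²([0,L)^{3N})` (`PeriodicFeynmanKacCompact`, `PeriodicFeynmanKacOperatorProps`); the generic
`L²` lemmas `inner_Lp_eq_integral`, `inner_pos_of_ae_pos` and the abstract spectral lemmas are
those of the Dirichlet files (`GroundStateFeynmanKacPerronFrobenius`, `GroundStateFeynmanKacSpectral`):

* `pfkReal_pos_of_nonneg` — **positivity improving, at every point**: for a bounded periodised
  potential `v^per ≤ C` the weight is bounded BELOW, `w_t ≥ e^{-N²Ct}`, so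
  `(e^{-tH} g)(X) ≥ e^{-N²Ct} E[g(X + √2 b_t)] > 0` for every periodic `g ≥ 0` not a.e. zero
  (the free heat kernel is strictly positive; no tubes are needed on the torus);
* `inner_pfkL2_le_inner_abs` — `⟪T f, f⟫ ≤ ⟪T |f|, |f|⟫` (`|T f| ≤ T |f|`);
* `pfkL2_abs_eigenvector` — if `T φ = ‖T‖ φ` then `T |φ| = ‖T‖ |φ|`;
* `pfkL2_coeFn_pos` — positivity improving on `L²(cell)`: `0 ≤ u ≠ 0 ⇒ T u > 0` a.e.;
* `pfkL2_perronFrobenius` — **`T` has the eigenvalue `‖T‖ > 0` with a unit eigenvector `e ≥ 0`,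
  a.e. strictly positive on the cell, spanning the `‖T‖`-eigenspace.**

## References

* M. Reed, B. Simon, *Methods of Modern Mathematical Physics IV* (1978), Thm XIII.44.
  [ReedSimonIV1978]
* J. Glimm, A. Jaffe, *Quantum Physics* (1987), Thms 3.3.2–3.3.3. [GlimmJaffeQP1987]
* K. L. Chung, Z. Zhao, *From Brownian Motion to Schrödinger's Equation* (1995), Thm 8.11 and
  its Corollary. [ChungZhao1995]
-/

noncomputable section

namespace Literature.MathematicalPhysics.QuantumManyBody.BoseGas

open MeasureTheory ProbabilityTheory Filter Set Metric
open scoped ENNReal NNReal Topology InnerProductSpace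
open Literature.Probability.Process

variable {N : ℕ}

/-! ### Positivity improving: the weight is bounded below on the torus -/

/-- **Lower bound for the periodic weight**: `e^{-N²Ct} ≤ w_t(X, ω)` for `v^per ≤ C`, `t ≥ 0`
(no killing on the torus). [folklore] -/
theorem expNeg_le_periodicFKWeight {v : ℝ → ℝ≥0∞} {L : ℝ} {C : ℝ≥0}
    (hC : ∀ x, periodizedPotential v L x ≤ C) (t : ℝ) (X : Config N) (ω : PathSpace N) :
    expNeg ((N * N : ℕ) * (C : ℝ≥0∞) * ENNReal.ofReal t) ≤ periodicFKWeight v L t X ω :=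
  expNeg_antitone (periodicPathAction_le_of_bound (C := (C : ℝ≥0∞)) (fun x => hC x) t X ω)

/-- The lower bound of the weight is a strictly positive finite number. [folklore] -/
theorem expNeg_bound_pos (N : ℕ) (C : ℝ≥0) (t : ℝ) :
    0 < expNeg ((N * N : ℕ) * (C : ℝ≥0∞) * ENNReal.ofReal t) := by
  have hM : ((N * N : ℕ) * (C : ℝ≥0∞) * ENNReal.ofReal t) ≠ ⊤ :=
    ENNReal.mul_ne_top (ENNReal.mul_ne_top (ENNReal.natCast_ne_top _) ENNReal.coe_ne_top)
      ENNReal.ofReal_ne_top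
  rw [expNeg, if_neg hM]
  exact ENNReal.ofReal_pos.2 (Real.exp_pos _)

/-- **The functional dominates a multiple of the free expectation**:
`e^{-N²Ct} E[G(B_t)] ≤ (e^{-tH} G)(X)` for `v^per ≤ C`. [folklore] -/
theorem mul_lintegral_worldLine_le_periodicFKSemigroup {v : ℝ → ℝ≥0∞} {L : ℝ} {C : ℝ≥0}
    (hC : ∀ x, periodizedPotential v L x ≤ C) (t : ℝ) (G : Config N → ℝ≥0∞) (X : Config N) :
    expNeg ((N * N : ℕ) * (C : ℝ≥0∞) * ENNReal.ofReal t) *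
        ∫⁻ ω, G (worldLine X ω t.toNNReal) ∂wienerPaths N ≤ periodicFKSemigroup v L t G X := by
  rw [← lintegral_const_mul' _ _ ((expNeg_le_one _).trans_lt ENNReal.one_lt_top).ne]
  exact lintegral_mono fun ω => mul_le_mul' (expNeg_le_periodicFKWeight hC t X ω) le_rfl

/-- The free heat kernel is strictly positive at positive times (product of positive Gaussian
densities). [folklore] -/
theorem heatKernel_pos (X Y : Config N) {t : ℝ≥0} (ht : t ≠ 0) :
    0 < ∏ i, ∏ k, gaussianPDF (X i k) (2 * t) (Y i k) := by
  have hv : (2 : ℝ≥0) * t ≠ 0 := mul_ne_zero two_ne_zero ht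
  refine pos_iff_ne_zero.2 (Finset.prod_ne_zero_iff.2 fun i _ =>
    Finset.prod_ne_zero_iff.2 fun k _ => ?_)
  exact (gaussianPDF_pos _ hv _).ne'

/-- **The free expectation of a nonnegative observable that is not a.e. zero is strictly
positive** (`t > 0`): `E[G(X + √2 b_t)] = ∫ p_t(X, Y) G(Y) dY > 0` since `p_t > 0` everywhere.
[folklore] -/
theorem lintegral_worldLine_pos (X : Config N) {t : ℝ≥0} (ht : t ≠ 0) {G : Config N → ℝ≥0∞}
    (hG : Measurable G) (hne : ¬ G =ᵐ[volume] 0) :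
    0 < ∫⁻ ω, G (worldLine X ω t) ∂wienerPaths N := by
  rw [lintegral_worldLine_eq X ht hG]
  refine pos_iff_ne_zero.2 fun h0 => hne ?_
  have hae := (lintegral_eq_zero_iff ((measurable_heatKernel X t).mul hG)).1 h0
  filter_upwards [hae] with Y hY
  rcases mul_eq_zero.1 hY with h | h
  · exact absurd h (heatKernel_pos X Y ht).ne'
  · exact h

/-- **Positivity improving of `e^{-tH_N^per}`, at every point**: for a bounded periodised potential
`v^per ≤ C`, `t > 0`, and a measurable periodic `g ≥ 0` square integrable on the cell and NOT
a.e. zero there, `(e^{-tH} g)(X) > 0` at EVERY `X ∈ (ℝ³)^N`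
(`(e^{-tH} g)(X) ≥ e^{-N²Ct} ∫ p_t(X,Y) g(Y) dY > 0`). Reed–Simon IV §XIII.12 (`e^{-tH}` is
positivity improving); Glimm–Jaffe Thm 3.3.3. [cite: ReedSimonIV1978, Thm XIII.44] -/
theorem pfkReal_pos_of_nonneg {v : ℝ → ℝ≥0∞} (hv : Measurable v) {L : ℝ} (hL : 0 < L) {C : ℝ≥0}
    (hC : ∀ x, periodizedPotential v L x ≤ C) {t : ℝ} (ht : 0 < t) {g : Config N → ℝ}
    (hg : Measurable g) (hg0 : ∀ Y, 0 ≤ g Y)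
    (hper : ∀ (Y : Config N) (i : Fin N) (k : Fin 3),
      g (Y + Pi.single i (EuclideanSpace.single k L)) = g Y)
    (hg2 : ∫⁻ Y in cellN N L, ‖g Y‖ₑ ^ (2 : ℝ) ≠ ⊤)
    (hne : ¬ g =ᵐ[volume.restrict (cellN N L)] 0) (X : Config N) :
    0 < pfkReal v L t g X := by
  set G : Config N → ℝ≥0∞ := fun Y => ENNReal.ofReal (g Y) with hGdef
  have hGm : Measurable G := hg.ennreal_ofReal
  have hGper : ∀ (Y : Config N) (i : Fin N) (k : Fin 3),
      G (Y + Pi.single i (EuclideanSpace.single k L)) = G Y := fun Y i k => by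
    simp only [hGdef, hper]
  have hG2 : ∫⁻ Y in cellN N L, G Y ^ (2 : ℝ) ≠ ⊤ := by
    convert hg2 using 1
    refine lintegral_congr fun Y => ?_
    rw [hGdef, Real.enorm_of_nonneg (hg0 Y)]
  -- `G` is not a.e. zero on the covering space
  have hGne : ¬ G =ᵐ[volume] 0 := by
    intro h0
    apply hne
    have h1 : G =ᵐ[volume.restrict (cellN N L)] 0 := ae_restrict_of_ae h0
    filter_upwards [h1] with Y hY
    have : ENNReal.ofReal (g Y) = 0 := hY
    exact le_antisymm (ENNReal.ofReal_eq_zero.1 this) (hg0 Y)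
  have ht' : t.toNNReal ≠ 0 := by simpa using ht
  have hlow := mul_lintegral_worldLine_le_periodicFKSemigroup hC t G X
  have hpos : 0 < periodicFKSemigroup v L t G X :=
    lt_of_lt_of_le (ENNReal.mul_pos (expNeg_bound_pos N C t).ne'
      (lintegral_worldLine_pos X ht' hGm hGne).ne') hlow
  have hfin : periodicFKSemigroup v L t G X < ⊤ :=
    periodicFKSemigroup_lt_top_of_cell v hL ht hGm hGper hG2 X
  rw [pfkReal_eq_toReal_periodicFKSemigroup hv L t hg hg0]
  exact ENNReal.toReal_pos hpos.ne' hfin.ne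

/-! ### `L²(cell)` bookkeeping -/

/-- The cell has positive Lebesgue measure (`L > 0`), so `L²(cell)` lives on a nonzero measure.
[folklore] -/
theorem restrict_cellN_ne_zero (N : ℕ) {L : ℝ} (hL : 0 < L) :
    (volume.restrict (cellN N L) : Measure (Config N)) ≠ 0 := by
  rw [Ne, Measure.restrict_eq_zero]
  exact volume_cellN_ne_zero N hL

/-! ### `|T f| ≤ T |f|` consequences -/

/-- **`⟪T f, f⟫ ≤ ⟪T |f|, |f|⟫`** for `T = e^{-tH}` on `L²(cell)` (`|T f| ≤ T |f|` a.e.). [folklore] -/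
theorem inner_pfkL2_le_inner_abs {v : ℝ → ℝ≥0∞} (hv : Measurable v) {L : ℝ} (hL : 0 < L) {t : ℝ}
    (ht : 0 < t) (f : Lp ℝ 2 (volume.restrict (cellN N L))) :
    ⟪pfkL2 v L t f, f⟫_ℝ ≤ ⟪pfkL2 v L t |f|, |f|⟫_ℝ := by
  rw [inner_Lp_eq_integral, inner_Lp_eq_integral]
  refine integral_mono_ae ((Lp.memLp _).integrable_mul (Lp.memLp f))
    ((Lp.memLp _).integrable_mul (Lp.memLp |f|)) ?_
  have hle := (Lp.coeFn_le _ _).2 (abs_pfkL2_le hv hL ht f)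
  filter_upwards [hle, Lp.coeFn_abs (pfkL2 v L t f), Lp.coeFn_abs f] with X h1 h2 h3
  rw [h3]
  calc (pfkL2 v L t f : Config N → ℝ) X * f X ≤ |(pfkL2 v L t f : Config N → ℝ) X| * |f X| := by
        rw [← abs_mul]; exact le_abs_self _
    _ ≤ (pfkL2 v L t |f| : Config N → ℝ) X * |f X| := by
        refine mul_le_mul_of_nonneg_right ?_ (abs_nonneg _)
        rw [← h2]; exact h1

/-- **The absolute value of an eigenvector for `‖T‖` is again one**: `T φ = ‖T‖ φ ⇒ T |φ| = ‖T‖ |φ|`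
(`|φ|/‖φ‖` maximises the Rayleigh quotient). Reed–Simon IV, proof of Thm XIII.44. [folklore] -/
theorem pfkL2_abs_eigenvector {v : ℝ → ℝ≥0∞} (hv : Measurable v) {L : ℝ} (hL : 0 < L) {t : ℝ}
    (ht : 0 < t) {φ : Lp ℝ 2 (volume.restrict (cellN N L))}
    (hφ : pfkL2 v L t φ = ‖pfkL2 (N := N) v L t‖ • φ) :
    pfkL2 v L t |φ| = ‖pfkL2 (N := N) v L t‖ • |φ| := by
  set T := pfkL2 v L t with hT
  rcases eq_or_ne φ 0 with rfl | hφ0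
  · simp
  · have hn : 0 < ‖φ‖ := norm_pos_iff.2 hφ0
    have hna : ‖|φ|‖ = ‖φ‖ := norm_abs_eq_norm φ
    set ψ : Lp ℝ 2 (volume.restrict (cellN N L)) := ‖φ‖⁻¹ • |φ| with hψ
    have hψ1 : ‖ψ‖ = 1 := by
      rw [hψ, norm_smul, norm_inv, norm_norm, hna, inv_mul_cancel₀ hn.ne']
    have hray : ⟪T ψ, ψ⟫_ℝ = ‖T‖ := by
      refine le_antisymm (rayleigh_le_opNorm T hψ1) ?_
      have h1 : ⟪T φ, φ⟫_ℝ = ‖T‖ * ‖φ‖ ^ 2 := by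
        rw [hφ, inner_smul_left, real_inner_self_eq_norm_sq]; simp
      have h2 := inner_pfkL2_le_inner_abs hv hL ht φ
      rw [hψ, map_smul, inner_smul_left, inner_smul_right]
      simp only [conj_trivial]
      rw [h1] at h2
      have : ‖T‖ = ‖φ‖⁻¹ * (‖φ‖⁻¹ * (‖T‖ * ‖φ‖ ^ 2)) := by field_simp
      rw [this]
      gcongr
    have heig := eq_smul_of_rayleigh_eq_norm T hψ1 hray
    -- unscale
    rw [hψ, map_smul, smul_smul] at heig
    have h2 := congrArg (fun x : Lp ℝ 2 (volume.restrict (cellN N L)) => ‖φ‖ • x) heig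
    simp only [smul_smul, mul_inv_cancel₀ hn.ne', one_smul] at h2
    rw [h2]
    congr 1
    field_simp

/-- **Positivity improving on `L²(cell)`**: for `0 ≤ u ≠ 0`, `(e^{-tH} u)(X) > 0` for a.e. `X` in
the cell (indeed at every point, `pfkReal_pos_of_nonneg`). [folklore] -/
theorem pfkL2_coeFn_pos {v : ℝ → ℝ≥0∞} (hv : Measurable v) {L : ℝ} (hL : 0 < L) {C : ℝ≥0}
    (hC : ∀ x, periodizedPotential v L x ≤ C) {t : ℝ} (ht : 0 < t)
    {u : Lp ℝ 2 (volume.restrict (cellN N L))} (hu0 : 0 ≤ u) (hu : u ≠ 0) :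
    ∀ᵐ X ∂volume.restrict (cellN N L), 0 < (pfkL2 v L t u : Config N → ℝ) X := by
  -- a nonnegative measurable representative, then its periodic extension
  set g : Config N → ℝ := fun Y => max (u Y) 0 with hg
  have hgm : Measurable g := (measurable_coeFn_Lp_cellN u).max measurable_const
  have hg0 : ∀ Y, 0 ≤ g Y := fun Y => le_max_right _ _
  have hgu : (u : Config N → ℝ) =ᵐ[volume.restrict (cellN N L)] g := by
    filter_upwards [(Lp.coeFn_nonneg u).2 hu0] with Y hY
    exact (max_eq_left hY).symm
  set gp : Config N → ℝ := g ∘ cellProj L with hgp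
  have hgpm : Measurable gp := hgm.comp (measurable_cellProj L)
  have hgp0 : ∀ Y, 0 ≤ gp Y := fun Y => hg0 _
  have hgpper : ∀ (Y : Config N) (i : Fin N) (k : Fin 3),
      gp (Y + Pi.single i (EuclideanSpace.single k L)) = gp Y := comp_cellProj_periodic hL.ne' _
  have hgpg : gp =ᵐ[volume.restrict (cellN N L)] g := comp_cellProj_ae_eq_restrict hL g
  have hg2 : ∫⁻ Y in cellN N L, ‖g Y‖ₑ ^ (2 : ℝ) ≠ ⊤ :=
    setLIntegral_cellN_enorm_posPart_sq_ne_top L (setLIntegral_cellN_enorm_sq_ne_top u)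
  have hgp2 : ∫⁻ Y in cellN N L, ‖gp Y‖ₑ ^ (2 : ℝ) ≠ ⊤ := by
    rw [hgp, setLIntegral_cellN_enorm_comp_cellProj_sq hL]; exact hg2
  have hne : ¬ gp =ᵐ[volume.restrict (cellN N L)] 0 := by
    intro h0
    exact hu (Lp.eq_zero_iff_ae_eq_zero.2 (hgu.trans (hgpg.symm.trans h0)))
  have hpos : ∀ X, 0 < pfkReal v L t gp X := fun X =>
    pfkReal_pos_of_nonneg hv hL hC ht hgpm hgp0 hgpper hgp2 hne X
  filter_upwards [pfkL2_coeFn hv hL ht u] with X hX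
  rw [hX, pfkReal_comp_cellProj_congr_ae v hL ht hgu X]
  exact hpos X

/-- A nonnegative nonzero eigenvector for `‖T‖` is a.e. strictly positive on the cell.
[folklore] -/
theorem pfkL2_coeFn_pos_of_eigenvector {v : ℝ → ℝ≥0∞} (hv : Measurable v) {L : ℝ} (hL : 0 < L)
    {C : ℝ≥0} (hC : ∀ x, periodizedPotential v L x ≤ C) {t : ℝ} (ht : 0 < t)
    (hT : pfkL2 (N := N) v L t ≠ 0) {φ : Lp ℝ 2 (volume.restrict (cellN N L))} (hφ0 : 0 ≤ φ)
    (hφ : φ ≠ 0) (heig : pfkL2 v L t φ = ‖pfkL2 (N := N) v L t‖ • φ) :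
    ∀ᵐ X ∂volume.restrict (cellN N L), 0 < (φ : Config N → ℝ) X := by
  have hTn : 0 < ‖pfkL2 (N := N) v L t‖ := norm_pos_iff.2 hT
  filter_upwards [pfkL2_coeFn_pos hv hL hC ht hφ0 hφ, Lp.coeFn_smul ‖pfkL2 (N := N) v L t‖ φ]
    with X h1 h2
  rw [heig, h2, Pi.smul_apply, smul_eq_mul] at h1
  exact (mul_pos_iff_of_pos_left hTn).1 h1

/-! ### The Perron–Frobenius theorem -/

set_option maxHeartbeats 800000 in
/-- **Simplicity from positivity improving**: if `e` is a unit eigenvector for `‖T‖` which is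
a.e. strictly positive, then every eigenvector for `‖T‖` is a multiple of `e` (otherwise
`f - ⟪e, f⟫ e` would be a nonzero eigenvector orthogonal to `e`, but nonzero eigenvectors have a
strict sign a.e.). Reed–Simon IV Thm XIII.44. [folklore] -/
theorem pfkL2_eigenvector_smul_of_pos {v : ℝ → ℝ≥0∞} (hv : Measurable v) {L : ℝ} (hL : 0 < L)
    {C : ℝ≥0} (hC : ∀ x, periodizedPotential v L x ≤ C) {t : ℝ} (ht : 0 < t)
    (hT0 : pfkL2 (N := N) v L t ≠ 0) {e : Lp ℝ 2 (volume.restrict (cellN N L))} (he1 : ‖e‖ = 1)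
    (hTe : pfkL2 v L t e = ‖pfkL2 (N := N) v L t‖ • e)
    (hepos : ∀ᵐ X ∂volume.restrict (cellN N L), 0 < (e : Config N → ℝ) X)
    (f : Lp ℝ 2 (volume.restrict (cellN N L))) (hf : pfkL2 v L t f = ‖pfkL2 (N := N) v L t‖ • f) :
    ∃ c : ℝ, f = c • e := by
  have hμ0 : (volume.restrict (cellN N L) : Measure (Config N)) ≠ 0 := restrict_cellN_ne_zero N hL
  haveI : (ae (volume.restrict (cellN N L) : Measure (Config N))).NeBot := ae_neBot.2 hμ0
  set c : ℝ := ⟪e, f⟫_ℝ with hc'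
  set f' : Lp ℝ 2 (volume.restrict (cellN N L)) := f - c • e with hf'
  have hf'eig : pfkL2 v L t f' = ‖pfkL2 (N := N) v L t‖ • f' := by
    rw [hf', (pfkL2 (N := N) v L t).map_sub, (pfkL2 (N := N) v L t).map_smul, hf, hTe, smul_sub,
      smul_comm]
  have hf'e : ⟪e, f'⟫_ℝ = 0 := by
    rw [hf', inner_sub_right, inner_smul_right, real_inner_self_eq_norm_sq, he1]; simp [hc']
  clear_value c f'
  by_cases hz : f' = 0
  · exact ⟨c, by rwa [hf', sub_eq_zero] at hz⟩
  · exfalso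
    have habs : pfkL2 v L t |f'| = ‖pfkL2 (N := N) v L t‖ • |f'| :=
      pfkL2_abs_eigenvector hv hL ht hf'eig
    -- positive and negative parts of the representative, as `L²` classes
    set r : Config N → ℝ := (f' : Config N → ℝ) with hr
    have hpm : MemLp (fun X => max (r X) 0) 2 (volume.restrict (cellN N L)) := (Lp.memLp f').pos_part
    have hqm : MemLp (fun X => max (-r X) 0) 2 (volume.restrict (cellN N L)) := (Lp.memLp f').neg_part
    obtain ⟨p, hpdef⟩ : ∃ p : Lp ℝ 2 (volume.restrict (cellN N L)), p = hpm.toLp _ := ⟨_, rfl⟩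
    obtain ⟨q, hqdef⟩ : ∃ q : Lp ℝ 2 (volume.restrict (cellN N L)), q = hqm.toLp _ := ⟨_, rfl⟩
    have hpc : (p : Config N → ℝ) =ᵐ[volume.restrict (cellN N L)] fun X => max (r X) 0 := by
      rw [hpdef]; exact hpm.coeFn_toLp
    have hqc : (q : Config N → ℝ) =ᵐ[volume.restrict (cellN N L)] fun X => max (-r X) 0 := by
      rw [hqdef]; exact hqm.coeFn_toLp
    -- `p = ½ (|f'| + f')`, `q = ½ (|f'| + (-f'))`
    have hp_eq : p = (1 / 2 : ℝ) • (|f'| + f') := by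
      refine Lp.ext ?_
      filter_upwards [hpc, Lp.coeFn_smul (1 / 2 : ℝ) (|f'| + f'), Lp.coeFn_add |f'| f',
        Lp.coeFn_abs f'] with X h1 h2 h3 h4
      rw [h1, h2, Pi.smul_apply, h3, Pi.add_apply, h4, smul_eq_mul]
      rcases le_total 0 (r X) with h | h
      · rw [max_eq_left h, abs_of_nonneg h]; ring
      · rw [max_eq_right h, abs_of_nonpos h]; ring
    have hq_eq : q = (1 / 2 : ℝ) • (|f'| + -f') := by
      refine Lp.ext ?_
      filter_upwards [hqc, Lp.coeFn_smul (1 / 2 : ℝ) (|f'| + -f'), Lp.coeFn_add |f'| (-f'),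
        Lp.coeFn_abs f', Lp.coeFn_neg f'] with X h1 h2 h3 h4 h5
      rw [h1, h2, Pi.smul_apply, h3, Pi.add_apply, h4, h5, Pi.neg_apply, smul_eq_mul]
      rcases le_total 0 (r X) with h | h
      · rw [max_eq_right (by linarith), abs_of_nonneg h]; ring
      · rw [max_eq_left (by linarith), abs_of_nonpos h]; ring
    have hpeig : pfkL2 v L t p = ‖pfkL2 (N := N) v L t‖ • p := by
      rw [hp_eq, (pfkL2 (N := N) v L t).map_smul, (pfkL2 (N := N) v L t).map_add, habs, hf'eig,
        ← smul_add, smul_comm]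
    have hqeig : pfkL2 v L t q = ‖pfkL2 (N := N) v L t‖ • q := by
      rw [hq_eq, (pfkL2 (N := N) v L t).map_smul, (pfkL2 (N := N) v L t).map_add,
        (pfkL2 (N := N) v L t).map_neg, habs, hf'eig, ← smul_neg, ← smul_add, smul_comm]
    have hp0 : 0 ≤ p := by
      rw [← Lp.coeFn_nonneg]
      filter_upwards [hpc] with X hX
      rw [hX]; exact le_max_right _ _
    have hq0 : 0 ≤ q := by
      rw [← Lp.coeFn_nonneg]
      filter_upwards [hqc] with X hX
      rw [hX]; exact le_max_right _ _
    -- not both parts vanish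
    have hpq : ¬ (p = 0 ∧ q = 0) := by
      rintro ⟨hp, hq⟩
      apply hz
      refine Lp.eq_zero_iff_ae_eq_zero.2 ?_
      have h1 : (p : Config N → ℝ) =ᵐ[volume.restrict (cellN N L)] 0 :=
        Lp.eq_zero_iff_ae_eq_zero.1 hp
      have h2 : (q : Config N → ℝ) =ᵐ[volume.restrict (cellN N L)] 0 :=
        Lp.eq_zero_iff_ae_eq_zero.1 hq
      filter_upwards [h1, h2, hpc, hqc] with X a1 a2 a3 a4
      rw [a3] at a1
      rw [a4] at a2
      simp only [Pi.zero_apply] at a1 a2 ⊢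
      have b1 : r X ≤ 0 := by have := le_max_left (r X) 0; linarith
      have b2 : -r X ≤ 0 := by have := le_max_left (-r X) 0; linarith
      show r X = 0
      linarith
    -- strict sign of `f'` a.e.
    have hsign : (∀ᵐ X ∂volume.restrict (cellN N L), 0 < r X) ∨
        (∀ᵐ X ∂volume.restrict (cellN N L), r X < 0) := by
      by_cases hp : p = 0
      · -- `q ≠ 0`: `r < 0` a.e.
        have hq : q ≠ 0 := fun hq => hpq ⟨hp, hq⟩
        right
        filter_upwards [pfkL2_coeFn_pos_of_eigenvector hv hL hC ht hT0 hq0 hq hqeig, hqc]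
          with X a1 a2
        rw [a2] at a1
        by_contra hge
        have : max (-r X) 0 = 0 := max_eq_right (by linarith [not_lt.1 hge])
        rw [this] at a1
        exact lt_irrefl 0 a1
      · left
        filter_upwards [pfkL2_coeFn_pos_of_eigenvector hv hL hC ht hT0 hp0 hp hpeig, hpc]
          with X a1 a2
        rw [a2] at a1
        by_contra hle
        have : max (r X) 0 = 0 := max_eq_right (not_lt.1 hle)
        rw [this] at a1
        exact lt_irrefl 0 a1
    rcases hsign with hs | hs
    · have := inner_pos_of_ae_pos hμ0 hepos hs
      rw [hf'e] at this
      exact lt_irrefl _ this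
    · have hneg : ∀ᵐ X ∂volume.restrict (cellN N L),
          0 < ((-f' : Lp ℝ 2 (volume.restrict (cellN N L))) : Config N → ℝ) X := by
        filter_upwards [hs, Lp.coeFn_neg f'] with X h1 h2
        rw [h2, Pi.neg_apply]
        simp only [hr] at h1
        linarith
      have := inner_pos_of_ae_pos hμ0 hepos hneg
      rw [inner_neg_right, hf'e, neg_zero] at this
      exact lt_irrefl _ this

/-- **Perron–Frobenius for `e^{-tH_N^per}` on `L²([0,L)^{3N})`** (`t > 0`, `L > 0`, `v` measurable
with bounded periodisation `v^per ≤ C`). The compact positive self-adjoint positivity-improving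
operator `T = pfkL2 v L t` is nonzero and has a unit eigenvector `e ≥ 0` for the eigenvalue `‖T‖`,
a.e. strictly positive on the cell, and every eigenvector for `‖T‖` is a multiple of `e`
(nondegenerate ground state of the torus Hamiltonian). Reed–Simon IV Thm XIII.44; Glimm–Jaffe
Thms 3.3.2–3.3.3; Chung–Zhao (1995) Thm 8.11 and its Corollary. [cite: ReedSimonIV1978, Thm XIII.44] -/
theorem pfkL2_perronFrobenius {v : ℝ → ℝ≥0∞} (hv : Measurable v) {L : ℝ} (hL : 0 < L) {C : ℝ≥0}
    (hC : ∀ x, periodizedPotential v L x ≤ C) {t : ℝ} (ht : 0 < t) :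
    pfkL2 (N := N) v L t ≠ 0 ∧ ∃ e : Lp ℝ 2 (volume.restrict (cellN N L)),
      ‖e‖ = 1 ∧ 0 ≤ e ∧ pfkL2 v L t e = ‖pfkL2 (N := N) v L t‖ • e ∧
      (∀ᵐ X ∂volume.restrict (cellN N L), 0 < (e : Config N → ℝ) X) ∧
      ∀ f, pfkL2 v L t f = ‖pfkL2 (N := N) v L t‖ • f → ∃ c : ℝ, f = c • e := by
  set μ : Measure (Config N) := volume.restrict (cellN N L) with hμ
  haveI hfin : IsFiniteMeasure μ :=
    ⟨by rw [hμ, Measure.restrict_apply_univ]; exact (volume_cellN_ne_top N L).lt_top⟩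
  have hμ0 : μ ≠ 0 := restrict_cellN_ne_zero N hL
  haveI : (ae μ).NeBot := ae_neBot.2 hμ0
  set T : Lp ℝ 2 μ →L[ℝ] Lp ℝ 2 μ := pfkL2 v L t with hT
  have hsym : ∀ x y, ⟪T x, y⟫_ℝ = ⟪x, T y⟫_ℝ := fun x y => inner_pfkL2_comm hv hL ht x y
  have hposT : ∀ x, 0 ≤ ⟪T x, x⟫_ℝ := fun x => inner_pfkL2_self_nonneg hv hL ht x
  have hc : IsCompactOperator T := isCompactOperator_pfkL2 hv hL hC ht
  -- `T ≠ 0`: the constant `1` is mapped to an a.e. positive function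
  have hT0 : T ≠ 0 := by
    set g₁ : Lp ℝ 2 μ := indicatorConstLp 2 MeasurableSet.univ (measure_ne_top μ _) (1 : ℝ) with hg₁
    have hg₁0 : 0 ≤ g₁ := by
      rw [← Lp.coeFn_nonneg]
      filter_upwards [indicatorConstLp_coeFn (p := 2) (μ := μ) (s := Set.univ) (hs := MeasurableSet.univ)
        (hμs := measure_ne_top μ _) (c := (1 : ℝ))] with X hX
      rw [hX]; simp
    have hg₁ne : g₁ ≠ 0 := by
      intro h0
      have h1 : (g₁ : Config N → ℝ) =ᵐ[μ] 0 := Lp.eq_zero_iff_ae_eq_zero.1 h0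
      have h2 := indicatorConstLp_coeFn (p := 2) (μ := μ) (s := Set.univ) (hs := MeasurableSet.univ)
        (hμs := measure_ne_top μ _) (c := (1 : ℝ))
      obtain ⟨X, hX1, hX2⟩ := (h1.and h2).exists
      rw [hX2] at hX1
      simp at hX1
    intro hT0
    have hpos := pfkL2_coeFn_pos hv hL hC ht hg₁0 hg₁ne
    have hzero : (T g₁ : Config N → ℝ) =ᵐ[μ] 0 := by
      rw [hT0]; exact Lp.coeFn_zero _ _ _
    obtain ⟨X, h1, h2⟩ := (hpos.and hzero).exists
    rw [h2] at h1
    exact lt_irrefl _ h1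
  -- the eigenvector
  obtain ⟨e₀, he₀, hTe₀⟩ := exists_eigenvector_norm T hsym hposT hc hT0
  set e : Lp ℝ 2 μ := |e₀| with he
  have he1 : ‖e‖ = 1 := by rw [he, norm_abs_eq_norm, he₀]
  have he0 : 0 ≤ e := by rw [he]; exact abs_nonneg e₀
  have hTe : T e = ‖T‖ • e := by rw [he]; exact pfkL2_abs_eigenvector hv hL ht hTe₀
  clear_value e
  have hene : e ≠ 0 := fun h0 => by rw [h0, norm_zero] at he1; exact zero_ne_one he1
  have hepos : ∀ᵐ X ∂μ, 0 < (e : Config N → ℝ) X :=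
    pfkL2_coeFn_pos_of_eigenvector hv hL hC ht hT0 he0 hene hTe
  exact ⟨hT0, e, he1, he0, hTe, hepos, fun f hf =>
    pfkL2_eigenvector_smul_of_pos hv hL hC ht hT0 he1 hTe hepos f hf⟩

end Literature.MathematicalPhysics.QuantumManyBody.BoseGas

end
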